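import Literature.Analysis.FluidPDE.BoundedL2ClassicalMild
import Literature.Analysis.FluidPDE.AncientMildWeak
import Literature.Analysis.FluidPDE.KNSSRegularityGluing
import HarnessLib

/-!
# Crux `ParabolicGaldiLiouville` (stmt-NavierStokesRegularity-0893), line `birth`, reshaping 3:
# STUB `stub_oseenMildOfL6` — duality-mild + continuous + uniformly-`L⁶` slices ⇒ Oseen-mild

Lands `--supports stmt-NavierStokesRegularity-0893` the registered transfer stub
`stub_oseenMildOfL6` of the lead's two-gate skeleton (lead c2): a bounded ancient mild solution
`v` of Navier–Stokes (`ν = 1`) in the tree's duality ("very weak") form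
`IsBoundedAncientMildSolution 1 v`, continuous on `(−∞,0) × ℝ³`, whose slices are UNIFORMLY in
`L⁶(ℝ³)`, solves the Oseen integral equation `v(t) = e^{(t−s)Δ}v(s) − B¹ₛ(v,v)(t)` pointwise for
all `s < t < 0` (the class of Albritton–Barker 2019, Thm 1.2). Proof = the tree template
`BoundedL2ClassicalMild.mild_of_bounded_of_eLpNorm_two_le_of_lt` (KNSS 2009, Lemma 3.1 in
drift-mild form + "finite `L^p` excludes the parasitic solutions", §1 p. 3) with `2 ↦ 6` and the
classical input replaced by the bounded weak form of the duality-mild solution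
(`IsBoundedAncientMildSolution.isBoundedWeakNSSolutionOn`), shifted to windows `(0, 1 − s)`:
at good times `r` the drift-free right-hand side `e^{(t′−r)Δ}v(r) − B¹_r(v,v)(t′)` lies in
`L⁶(ℝ³)` (heat flow contracts `L⁶`; Minkowski in time with the `L⁶ → L⁶` Oseen slice bound
`≲ (t′−σ)^{-1/2}` and `‖ |v||v| ‖₆ ≤ L ‖v‖₆ ≤ L K`), so the constant drift increment
`b(r₂) − b(r₁) ∈ L⁶(ℝ³)` vanishes; continuity in time upgrades good pairs to all pairs.

References: G. Koch, N. Nadirashvili, G. Seregin, V. Šverák, Acta Math. 203 (2009) =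
arXiv:0709.3599, §1 p. 3, §3 Lemma 3.1, §4 (i)–(ii); D. Albritton, T. Barker, arXiv:1811.00502,
Thm 1.2.
-/

noncomputable section

-- `Sub = summit`: the duplicated namespace component `NavierStokesRegularity` is deliberate.
set_option linter.dupNamespace false

open MeasureTheory Set Function Filter TopologicalSpace Metric
open Topology
open scoped ENNReal NNReal RealInnerProductSpace
open Literature.Analysis Literature.Analysis.FluidPDE

namespace Summit.NavierStokesRegularity.NavierStokesRegularity.Theorems

namespace ParabolicGaldiLiouville.Birth

namespace OseenMildOfL6

/-- **Window form.** A bounded weak solution `v` of Navier–Stokes (`ν = 1`, KNSS class) on the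
window `(0, T₁) × ℝ³`, continuous there, with `‖v‖ ≤ L` and `‖v(r)‖_{L⁶} ≤ K` for all
`r ∈ (0, T₁)`, solves `v(t′) = e^{(t′−r)Δ}v(r) − B¹ᵣ(v,v)(t′)` pointwise for all
`0 < r < t′ < T₁` (KNSS 2009 Lemma 3.1 in drift-mild form; the parasitic drift increment is a
constant in `L⁶(ℝ³)`, hence zero; continuity in time). -/
theorem oseenMild_window {T₁ : ℝ} (hT₁pos : 0 < T₁)
    {v : ℝ → EuclideanSpace ℝ (Fin 3) → EuclideanSpace ℝ (Fin 3)}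
    (hweak : IsBoundedWeakNSSolutionOn (Ioo 0 T₁) isOpen_Ioo 1 v)
    (hcontv : ContinuousOn (uncurry v) (Ioo 0 T₁ ×ˢ univ))
    {L : ℝ} (hvL : ∀ r ∈ Ioo 0 T₁, ∀ y, ‖v r y‖ ≤ L)
    {K : ℝ≥0} (hvK : ∀ r ∈ Ioo 0 T₁, eLpNorm (v r) 6 volume ≤ K)
    {r₀ t₀ : ℝ} (hr₀ : 0 < r₀) (hr₀t₀ : r₀ < t₀) (ht₀T : t₀ < T₁) (x : EuclideanSpace ℝ (Fin 3)) :
    v t₀ x = UnboundedOperators.heatExtension (v r₀) (t₀ - r₀) x - oseenDuhamel 1 r₀ v v t₀ x := by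
  -- ### Step 1: Lemma 3.1 on the window
  have hL0 : 0 ≤ L := (norm_nonneg _).trans (hvL r₀ ⟨hr₀, hr₀t₀.trans ht₀T⟩ 0)
  have hcontv_slice : ∀ r ∈ Ioo 0 T₁, Continuous (v r) := fun r hr =>
    hcontv.comp_continuous (continuous_const.prodMk continuous_id) fun y => ⟨hr, mem_univ y⟩
  have hmeasv : ∀ {s₁ s₂ : ℝ}, 0 ≤ s₁ → s₂ ≤ T₁ → AEStronglyMeasurable (uncurry v)
      ((volume : Measure (ℝ × EuclideanSpace ℝ (Fin 3))).restrict (Ioo s₁ s₂ ×ˢ univ)) :=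
    fun {s₁ s₂} h1 h2 => (hcontv.mono (prod_mono (Ioo_subset_Ioo h1 h2) subset_rfl)).aestronglyMeasurable
      (measurableSet_Ioo.prod MeasurableSet.univ)
  obtain ⟨N, hN⟩ := KNSS2009_weak_driftMild_holds L T₁ hT₁pos
  obtain ⟨U, bd, hUb, hae⟩ := hN hweak hvL
  -- the good times
  set G : Set ℝ := {r | r ∈ Ioo 0 T₁ ∧ v r =ᵐ[volume] fun y => U r y + bd r}
  have hGae : ∀ᵐ r ∂((volume : Measure ℝ).restrict (Ioo 0 T₁)), r ∈ G := by
    filter_upwards [hae, ae_restrict_mem measurableSet_Ioo] with r h1 h2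
    exact ⟨h2, h1⟩
  -- ### Step 2: the representation with drift at good initial times
  -- the drift-free right-hand side
  set R : ℝ → ℝ → EuclideanSpace ℝ (Fin 3) → EuclideanSpace ℝ (Fin 3) := fun r t' y =>
    UnboundedOperators.heatExtension (v r) (t' - r) y - oseenDuhamel 1 r v v t' y with hRdef
  have hUslice : ∀ σ, Measurable (U σ) := fun σ =>
    hUb.measurable.comp (measurable_const.prodMk measurable_id)
  have hA : ∀ r ∈ G, ∀ t' : ℝ, r < t' → t' < T₁ → ∀ y, U t' y = R r t' y - bd r := by
    intro r hr t' hrt' ht' y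
    have hr0 : 0 < r := hr.1.1
    have hmild := hUb.mild r t' hr0 hrt' ht' y
    -- the caloric term
    have hcal : UnboundedOperators.heatExtension (U r) (t' - r) y =
        UnboundedOperators.heatExtension (v r) (t' - r) y - bd r := by
      have hae_r : U r =ᵐ[volume] fun z => v r z - bd r := by
        filter_upwards [hr.2] with z hz
        rw [hz]; abel
      rw [UnboundedOperators.heatExtension_congr_ae' hae_r,
        UnboundedOperators.heatExtension_sub_of_bound (hcontv_slice r hr.1) continuous_const
          (hvL r hr.1) (fun _ => le_rfl) (sub_pos.2 hrt') y,
        UnboundedOperators.heatExtension_const _ (sub_pos.2 hrt') y]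
    -- the Duhamel term through the bridge and the a.e. identification of the slices
    have hduh : driftDuhamel U bd r t' y = oseenDuhamel 1 r v v t' y := by
      have hNN : ∀ σ ∈ Ioo r t', ∀ z, ‖U σ z + bd σ‖ ≤ N + N := fun σ hσ z =>
        (norm_add_le _ _).trans (add_le_add (hUb.norm_le σ ⟨hr0.trans hσ.1, hσ.2.trans ht'⟩ z)
          (hUb.norm_drift_le σ))
      rw [driftDuhamel_eq_oseenDuhamel_drift (fun σ _ => hUslice σ) hNN hrt'.le y]
      refine oseenDuhamel_congr_ae_slices ?_ y
      have hsub : Ioo r t' ⊆ Ioo 0 T₁ := Ioo_subset_Ioo hr0.le ht'.le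
      filter_upwards [ae_restrict_of_ae_restrict_of_subset hsub hae] with σ hσ
      exact hσ.symm
    rw [hmild, hcal, hduh]
    simp only [hRdef]
    abel
  -- ### Step 3: the drift is constant on the good times (finite `L⁶` norm kills constants)
  -- continuity of the drift-free right-hand side in `y`
  have hRcont : ∀ r ∈ Ioo 0 T₁, ∀ t' : ℝ, r < t' → t' ≤ T₁ → Continuous (R r t') := by
    intro r hr t' hrt' ht'
    have h1 : Continuous (UnboundedOperators.heatExtension (v r) (t' - r)) :=
      (UnboundedOperators.contDiff_heatExtension_holds
        (UnboundedOperators.memLp_top_of_continuous_of_bound (hcontv_slice r hr) (hvL r hr)) le_top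
        (sub_pos.2 hrt')).continuous
    have h2 : Continuous (oseenDuhamel 1 r v v t') :=
      continuous_oseenDuhamel_slice one_pos hL0 (hmeasv hr.1.le ht') (hmeasv hr.1.le ht')
        (fun τ hτ y => hvL τ ⟨hr.1.trans hτ.1, hτ.2.trans_le ht'⟩ y)
        (fun τ hτ y => hvL τ ⟨hr.1.trans hτ.1, hτ.2.trans_le ht'⟩ y) hrt' le_rfl
    exact h1.sub h2
  -- a globally measurable representative of `v` on the window (zero outside)
  classical
  set W : ℝ → EuclideanSpace ℝ (Fin 3) → EuclideanSpace ℝ (Fin 3) := fun σ y =>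
    (Ioo 0 T₁ ×ˢ univ).piecewise (uncurry v) 0 (σ, y)
  have hWv : ∀ σ ∈ Ioo 0 T₁, W σ = v σ := fun σ hσ => funext fun y =>
    (Ioo 0 T₁ ×ˢ univ).piecewise_eq_of_mem _ _ (mk_mem_prod hσ (mem_univ y))
  have hWmeas : Measurable (uncurry W) :=
    hcontv.measurable_piecewise continuousOn_const (measurableSet_Ioo.prod MeasurableSet.univ)
  -- the `L⁶` slice bound for the Oseen slice operator
  obtain ⟨C₆, hC₆0, hS₆⟩ := exists_eLpNorm_oseenSlice_le (E := EuclideanSpace ℝ (Fin 3))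
    (p := 6) (q := 6) (by norm_num) (by norm_num) le_rfl
  have hexp : -(1 / 2 : ℝ) - (Module.finrank ℝ (EuclideanSpace ℝ (Fin 3)) : ℝ) / 2 *
      (1 / (6 : ℝ≥0∞).toReal - 1 / (6 : ℝ≥0∞).toReal) = -(1 / 2 : ℝ) := by ring
  -- `R r t'` has finite `L⁶` norm for window times `r < t' ≤ T₁`
  have hRL6 : ∀ r ∈ Ioo 0 T₁, ∀ t' : ℝ, r < t' → t' ≤ T₁ → eLpNorm (R r t') 6 volume < ∞ := by
    intro r hr t' hrt' ht'
    -- the caloric part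
    have hvmem : MemLp (v r) 6 volume :=
      ⟨(hcontv_slice r hr).aestronglyMeasurable, (hvK r hr).trans_lt ENNReal.coe_lt_top⟩
    have hcal : eLpNorm (UnboundedOperators.heatExtension (v r) (t' - r)) 6 volume ≤ K :=
      (UnboundedOperators.eLpNorm_heatExtension_le_holds hvmem (by norm_num) (sub_pos.2 hrt')).trans
        (hvK r hr)
    -- the Duhamel part through the measurable representative
    have hsubI : Ioo r t' ⊆ Ioo 0 T₁ := Ioo_subset_Ioo hr.1.le ht'
    have hcongr : oseenDuhamel 1 r v v t' = oseenDuhamel 1 r W W t' := by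
      funext y
      refine oseenDuhamel_congr_ae_slices ?_ y
      filter_upwards [ae_restrict_mem measurableSet_Ioo] with σ hσ
      rw [hWv σ (hsubI hσ)]
    have hslice : ∀ σ ∈ Ioo r t',
        eLpNorm (fun x => ∫ y, oseenKernel (t' - σ) (x - y) (W σ y) (W σ y)) 6 volume ≤
          ENNReal.ofReal ((t' - σ) ^ (-(1 / 2 : ℝ))) * (ENNReal.ofReal (C₆ * L) * K) := by
      intro σ hσ
      have hσ0 : 0 < t' - σ := sub_pos.2 hσ.2
      have hσI : σ ∈ Ioo 0 T₁ := hsubI hσ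
      have hWm : AEStronglyMeasurable (W σ) volume := by
        rw [hWv σ hσI]; exact (hcontv_slice σ hσI).aestronglyMeasurable
      have h1 := hS₆ hσ0 hWm hWm
      rw [hexp] at h1
      have h2 : eLpNorm (fun y => ‖W σ y‖ * ‖W σ y‖) 6 volume ≤ ENNReal.ofReal L * K := by
        have hpt : ∀ᵐ y ∂(volume : Measure (EuclideanSpace ℝ (Fin 3))),
            ‖‖W σ y‖ * ‖W σ y‖‖ ≤ L.toNNReal * ‖W σ y‖ := by
          refine Eventually.of_forall fun y => ?_
          rw [norm_mul, norm_norm, hWv σ hσI, Real.coe_toNNReal L hL0]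
          exact mul_le_mul_of_nonneg_right (hvL σ hσI y) (norm_nonneg _)
        refine (eLpNorm_le_nnreal_smul_eLpNorm_of_ae_le_mul hpt 6).trans ?_
        rw [ENNReal.smul_def, smul_eq_mul, hWv σ hσI]
        exact mul_le_mul' (le_of_eq rfl) (hvK σ hσI)
      calc eLpNorm (fun x => ∫ y, oseenKernel (t' - σ) (x - y) (W σ y) (W σ y)) 6 volume
          ≤ ENNReal.ofReal (C₆ * (t' - σ) ^ (-(1 / 2 : ℝ))) *
              eLpNorm (fun y => ‖W σ y‖ * ‖W σ y‖) 6 volume := h1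
        _ ≤ ENNReal.ofReal (C₆ * (t' - σ) ^ (-(1 / 2 : ℝ))) * (ENNReal.ofReal L * K) :=
            mul_le_mul_right h2 _
        _ = ENNReal.ofReal ((t' - σ) ^ (-(1 / 2 : ℝ))) * (ENNReal.ofReal (C₆ * L) * K) := by
            rw [ENNReal.ofReal_mul hC₆0, ENNReal.ofReal_mul hC₆0]
            have : (0 : ℝ) ≤ (t' - σ) ^ (-(1 / 2 : ℝ)) := Real.rpow_nonneg hσ0.le _
            ring
    have hduh : eLpNorm (oseenDuhamel 1 r v v t') 6 volume < ∞ := by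
      rw [hcongr]
      refine (eLpNorm_oseenDuhamel_one_le_lintegral hWmeas hWmeas (p := 6) (by norm_num)
        (by norm_num) r t').trans_lt ?_
      calc ∫⁻ σ in Ioo r t', eLpNorm (fun x => ∫ y, oseenKernel (t' - σ) (x - y) (W σ y) (W σ y)) 6 volume
          ≤ ∫⁻ σ in Ioo r t', ENNReal.ofReal ((t' - σ) ^ (-(1 / 2 : ℝ))) * (ENNReal.ofReal (C₆ * L) * K) :=
            setLIntegral_mono' measurableSet_Ioo fun σ hσ => hslice σ hσ
        _ = (∫⁻ σ in Ioo r t', ENNReal.ofReal ((t' - σ) ^ (-(1 / 2 : ℝ)))) * (ENNReal.ofReal (C₆ * L) * K) :=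
            lintegral_mul_const _ (measurable_ofReal_rpow_sub_left t' (1 / 2))
        _ ≤ ENNReal.ofReal ((t' - r) ^ (1 - 1 / 2 : ℝ) / (1 - 1 / 2)) * (ENNReal.ofReal (C₆ * L) * K) :=
            mul_le_mul_left (lintegral_Ioo_ofReal_rpow_neg_sub_le (γ := 1 / 2) (by norm_num) hrt'.le le_rfl) _
        _ < ∞ := ENNReal.mul_lt_top ENNReal.ofReal_lt_top
            (ENNReal.mul_lt_top ENNReal.ofReal_lt_top ENNReal.coe_lt_top)
    -- assemble
    have hm1 : AEStronglyMeasurable (UnboundedOperators.heatExtension (v r) (t' - r)) volume :=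
      (UnboundedOperators.contDiff_heatExtension_holds
        (UnboundedOperators.memLp_top_of_continuous_of_bound (hcontv_slice r hr) (hvL r hr)) le_top
        (sub_pos.2 hrt')).continuous.aestronglyMeasurable
    have hm2 : AEStronglyMeasurable (oseenDuhamel 1 r v v t') volume :=
      (continuous_oseenDuhamel_slice one_pos hL0 (hmeasv hr.1.le ht') (hmeasv hr.1.le ht')
        (fun τ hτ y => hvL τ ⟨hr.1.trans hτ.1, hτ.2.trans_le ht'⟩ y)
        (fun τ hτ y => hvL τ ⟨hr.1.trans hτ.1, hτ.2.trans_le ht'⟩ y) hrt' le_rfl).aestronglyMeasurable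
    calc eLpNorm (R r t') 6 volume
        ≤ eLpNorm (UnboundedOperators.heatExtension (v r) (t' - r)) 6 volume +
            eLpNorm (oseenDuhamel 1 r v v t') 6 volume := eLpNorm_sub_le hm1 hm2 (by norm_num)
      _ < ∞ := ENNReal.add_lt_top.2 ⟨hcal.trans_lt ENNReal.coe_lt_top, hduh⟩
  have hB_lt : ∀ r₁ ∈ G, ∀ r₂ ∈ G, r₁ < r₂ → bd r₁ = bd r₂ := by
    intro r₁ hr₁ r₂ hr₂ h12
    set t' : ℝ := (r₂ + T₁) / 2 with ht'
    have h2t' : r₂ < t' := by rw [ht']; linarith [hr₂.1.2]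
    have ht'T : t' < T₁ := by rw [ht']; linarith [hr₂.1.2]
    have h1t' : r₁ < t' := h12.trans h2t'
    have key : ∀ y, bd r₂ - bd r₁ = R r₂ t' y - R r₁ t' y := by
      intro y
      have e1 := hA r₁ hr₁ t' h1t' ht'T y
      have e2 := hA r₂ hr₂ t' h2t' ht'T y
      rw [e1] at e2
      -- `e2 : R r₁ t' y - bd r₁ = R r₂ t' y - bd r₂`
      calc bd r₂ - bd r₁ = (R r₂ t' y - (R r₂ t' y - bd r₂)) - (R r₁ t' y - (R r₁ t' y - bd r₁)) := by abel
        _ = (R r₂ t' y - (R r₁ t' y - bd r₁)) - (R r₁ t' y - (R r₁ t' y - bd r₁)) := by rw [← e2]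
        _ = R r₂ t' y - R r₁ t' y := by abel
    have hzero : bd r₂ - bd r₁ = 0 := by
      refine eq_zero_of_eLpNorm_const_lt_top (E := EuclideanSpace ℝ (Fin 3)) (p := 6) (by norm_num)
        (by norm_num) ?_
      have hfun : (fun _ : EuclideanSpace ℝ (Fin 3) => bd r₂ - bd r₁) = R r₂ t' - R r₁ t' := by
        funext y; rw [key y]; rfl
      rw [hfun]
      have hm : ∀ r ∈ Ioo 0 T₁, r < t' → AEStronglyMeasurable (R r t') volume := fun r hr hrt =>
        (hRcont r hr t' hrt ht'T.le).aestronglyMeasurable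
      calc eLpNorm (R r₂ t' - R r₁ t') 6 volume
          ≤ eLpNorm (R r₂ t') 6 volume + eLpNorm (R r₁ t') 6 volume :=
            eLpNorm_sub_le (hm r₂ hr₂.1 h2t') (hm r₁ hr₁.1 h1t') (by norm_num)
        _ < ∞ := ENNReal.add_lt_top.2 ⟨hRL6 r₂ hr₂.1 t' h2t' ht'T.le, hRL6 r₁ hr₁.1 t' h1t' ht'T.le⟩
    exact (sub_eq_zero.1 hzero).symm
  have hB : ∀ r₁ ∈ G, ∀ r₂ ∈ G, bd r₁ = bd r₂ := fun r₁ hr₁ r₂ hr₂ => by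
    rcases lt_trichotomy r₁ r₂ with h | h | h
    · exact hB_lt r₁ hr₁ r₂ hr₂ h
    · rw [h]
    · exact (hB_lt r₂ hr₂ r₁ hr₁ h).symm
  -- ### Step 4: good pairs
  have hC : ∀ r ∈ G, ∀ t' ∈ G, r < t' → ∀ y, v t' y = R r t' y := by
    intro r hr t' ht' hrt' y
    have hae' : v t' =ᵐ[volume] R r t' := by
      filter_upwards [ht'.2] with z hz
      rw [hz, hA r hr t' hrt' ht'.1.2 z, hB t' ht' r hr]
      abel
    have heq := (Continuous.ae_eq_iff_eq volume (hcontv_slice t' ht'.1) (hRcont r hr.1 t' hrt' ht'.1.2.le)).1 hae'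
    exact congrFun heq y
  -- ### Step 5: all pairs
  -- (a) good initial time, any later time
  have hC' : ∀ r ∈ G, ∀ t' : ℝ, r < t' → t' < T₁ → ∀ y, v t' y = R r t' y := by
    intro r hr t' hrt' ht'T y
    have hr0 : 0 < r := hr.1.1
    have hsub : v t' y - R r t' y = 0 := by
      refine eq_zero_of_forall_norm_le fun ε hε => ?_
      -- continuity of `v` in time at `(t', y)`
      have hvc : ContinuousAt (fun σ => v σ y) t' := by
        have hc : ContinuousAt (uncurry v) (t', y) :=
          hcontv.continuousAt ((isOpen_Ioo.prod isOpen_univ).mem_nhds ⟨⟨hr0.trans hrt', ht'T⟩, mem_univ _⟩)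
        have hg : ContinuousAt (fun σ : ℝ => (σ, y)) t' :=
          (continuous_id.prodMk continuous_const).continuousAt
        exact ContinuousAt.comp (g := uncurry v) (f := fun σ : ℝ => (σ, y)) hc hg
      have e1 : ∀ᶠ σ in 𝓝 t', ‖v σ y - v t' y‖ < ε / 3 := by
        have := (Metric.tendsto_nhds.1 hvc) (ε / 3) (by positivity)
        simpa only [dist_eq_norm] using this
      -- continuity of the caloric term in time
      have hcalc : ContinuousAt (fun σ => UnboundedOperators.heatExtension (v r) (σ - r) y) t' := by
        have hd := UnboundedOperators.hasDerivAt_heatExtension_time (sub_pos.2 hrt')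
          (UnboundedOperators.memLp_top_of_continuous_of_bound (hcontv_slice r hr.1) (hvL r hr.1)) le_top y
        have hg : ContinuousAt (fun σ : ℝ => σ - r) t' := (continuous_id.sub continuous_const).continuousAt
        exact ContinuousAt.comp (g := fun σ => UnboundedOperators.heatExtension (v r) σ y)
          (f := fun σ : ℝ => σ - r) hd.continuousAt hg
      have e2 : ∀ᶠ σ in 𝓝 t', ‖UnboundedOperators.heatExtension (v r) (σ - r) y -
          UnboundedOperators.heatExtension (v r) (t' - r) y‖ < ε / 3 := by
        have := (Metric.tendsto_nhds.1 hcalc) (ε / 3) (by positivity)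
        simpa only [dist_eq_norm] using this
      -- continuity of the Duhamel term in time (uniform modulus)
      obtain ⟨δ, hδ, hmod⟩ := exists_forall_norm_oseenDuhamel_sub_le (E := EuclideanSpace ℝ (Fin 3))
        one_pos hT₁pos hL0 (by positivity : (0 : ℝ) < ε / 3)
      have e3 : ∀ᶠ σ in 𝓝 t', σ < t' + δ := Iio_mem_nhds (by linarith)
      have e4 : ∀ᶠ σ in 𝓝 t', σ < T₁ := Iio_mem_nhds ht'T
      -- a good time slightly to the right of `t'`
      obtain ⟨ρ, hρ, hgood⟩ := Metric.eventually_nhds_iff.1 (e1.and (e2.and (e3.and e4)))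
      have hρ' : 0 < min ρ (T₁ - t') := lt_min hρ (sub_pos.2 ht'T)
      obtain ⟨σ, hσI, hσG⟩ := exists_mem_Ioo_of_ae_mem hGae (hr0.trans hrt').le
        (show t' < t' + min ρ (T₁ - t') / 2 by linarith)
        (by linarith [min_le_right ρ (T₁ - t')])
      have hσdist : dist σ t' < ρ := by
        rw [Real.dist_eq, abs_of_pos (sub_pos.2 hσI.1)]
        linarith [hσI.2, min_le_left ρ (T₁ - t')]
      obtain ⟨g1, g2, g3, g4⟩ := hgood hσdist
      have hvσ : v σ y = R r σ y := hC r hr σ hσG (hrt'.trans hσI.1) y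
      -- the Duhamel increment between `t'` and `σ`
      have hduh : ‖oseenDuhamel 1 r v v σ y - oseenDuhamel 1 r v v t' y‖ ≤ ε / 3 :=
        hmod (by linarith) (hmeasv hr0.le le_rfl) (hmeasv hr0.le le_rfl)
          (fun τ hτ z => hvL τ ⟨hr0.trans hτ.1, hτ.2⟩ z) (fun τ hτ z => hvL τ ⟨hr0.trans hτ.1, hτ.2⟩ z)
          hrt'.le hσI.1.le g4.le (by linarith [hσI.2, min_le_left ρ (T₁ - t')]) y
      have hRR : ‖R r σ y - R r t' y‖ ≤ ε / 3 + ε / 3 := by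
        simp only [hRdef]
        calc _ = ‖(UnboundedOperators.heatExtension (v r) (σ - r) y -
              UnboundedOperators.heatExtension (v r) (t' - r) y) -
            (oseenDuhamel 1 r v v σ y - oseenDuhamel 1 r v v t' y)‖ := by abel_nf
          _ ≤ ‖UnboundedOperators.heatExtension (v r) (σ - r) y -
              UnboundedOperators.heatExtension (v r) (t' - r) y‖ +
            ‖oseenDuhamel 1 r v v σ y - oseenDuhamel 1 r v v t' y‖ := norm_sub_le _ _
          _ ≤ ε / 3 + ε / 3 := add_le_add g2.le hduh
      have g1' : ‖v t' y - v σ y‖ ≤ ε / 3 := by rw [norm_sub_rev]; exact g1.le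
      calc ‖v t' y - R r t' y‖ = ‖(v t' y - v σ y) + (R r σ y - R r t' y)‖ := by rw [hvσ]; abel_nf
        _ ≤ ‖v t' y - v σ y‖ + ‖R r σ y - R r t' y‖ := norm_add_le _ _
        _ ≤ ε / 3 + (ε / 3 + ε / 3) := add_le_add g1' hRR
        _ = ε := by ring
    exact sub_eq_zero.1 hsub
  -- (b) any initial time
  have hsub : v t₀ x - R r₀ t₀ x = 0 := by
    refine eq_zero_of_forall_norm_le fun ε hε => ?_
    have h1 : ContinuousAt (fun ρ => UnboundedOperators.heatExtension (v ρ) (t₀ - ρ) x) r₀ :=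
      continuousAt_heatExtension_datum hcontv hvL hr₀ (hr₀t₀.trans ht₀T) hr₀t₀ x
    have h2 : ContinuousAt (fun ρ => oseenDuhamel 1 ρ v v t₀ x) r₀ :=
      continuousAt_oseenDuhamel_initialTime hcontv hL0 hvL hr₀ hr₀t₀ ht₀T.le x
    have hRc : ContinuousAt (fun ρ => R ρ t₀ x) r₀ := h1.sub h2
    have e1 : ∀ᶠ ρ in 𝓝 r₀, ‖R ρ t₀ x - R r₀ t₀ x‖ < ε := by
      have := (Metric.tendsto_nhds.1 hRc) ε hε
      simpa only [dist_eq_norm] using this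
    obtain ⟨δ, hδ, hgood⟩ := Metric.eventually_nhds_iff.1 e1
    have hδ' : 0 < min δ (t₀ - r₀) := lt_min hδ (sub_pos.2 hr₀t₀)
    obtain ⟨ρ, hρI, hρG⟩ := exists_mem_Ioo_of_ae_mem hGae hr₀.le
      (show r₀ < r₀ + min δ (t₀ - r₀) / 2 by linarith) (by linarith [min_le_right δ (t₀ - r₀), ht₀T])
    have hρdist : dist ρ r₀ < δ := by
      rw [Real.dist_eq, abs_of_pos (sub_pos.2 hρI.1)]
      linarith [hρI.2, min_le_left δ (t₀ - r₀)]
    have hρt₀ : ρ < t₀ := by linarith [hρI.2, min_le_right δ (t₀ - r₀)]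
    have hvρ : v t₀ x = R ρ t₀ x := hC' ρ hρG t₀ hρt₀ ht₀T x
    rw [hvρ]
    exact (hgood hρdist).le
  have key := sub_eq_zero.1 hsub
  simpa only [hRdef] using key

end OseenMildOfL6

open OseenMildOfL6 in
/-- **STUB O — `stub_oseenMildOfL6` (lead c2, reshaping 3).** A bounded ancient mild solution of
Navier–Stokes (`ν = 1`) in the tree's duality form, continuous on `(−∞,0) × ℝ³`, whose slices are
UNIFORMLY in `L⁶` (`‖v(s)‖_{L⁶} ≤ K` for all `s < 0`), solves the Oseen integral equation
`v(t) = e^{(t−s)Δ}v(s) − B¹ₛ(v,v)(t)` pointwise for all `s < t < 0`. Proof: duality-mild ⇒ bounded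
weak on `(−∞,0)` (`IsBoundedAncientMildSolution.isBoundedWeakNSSolutionOn`), restricted and
shifted to the window `(0, 1 − s)` (`t ↦ t + (s − 1)`), where `oseenMild_window` applies between
the times `1 < t − s + 1 < 1 − s`; translate back (`oseenDuhamel_translate`). -/
theorem stub_oseenMildOfL6 :
    ∀ v : ℝ → EuclideanSpace ℝ (Fin 3) → EuclideanSpace ℝ (Fin 3),
      Literature.Analysis.FluidPDE.IsBoundedAncientMildSolution 1 v →
      ContinuousOn (Function.uncurry v) (Set.Iio 0 ×ˢ Set.univ) →
      (∃ K : NNReal, ∀ s < 0, MeasureTheory.eLpNorm (v s) 6 MeasureTheory.volume ≤ K) →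
      ∀ s t : ℝ, s < t → t < 0 → ∀ x,
        v t x = Literature.Analysis.UnboundedOperators.heatExtension (v s) (t - s) x -
          Literature.Analysis.FluidPDE.oseenDuhamel 1 s v v t x := by
  intro v hv hcont hK6 s t hst ht0 x
  obtain ⟨K, hK⟩ := hK6
  obtain ⟨C, hC⟩ := hv.2
  -- the bounded weak form on `(−∞, 0)`
  have hslice : ∀ τ < 0, Continuous (v τ) := fun τ hτ =>
    hcont.comp_continuous (continuous_const.prodMk continuous_id) fun y => ⟨hτ, mem_univ y⟩
  have hjm : AEStronglyMeasurable (uncurry v)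
      ((volume : Measure (ℝ × EuclideanSpace ℝ (Fin 3))).restrict (Iio 0 ×ˢ univ)) :=
    hcont.aestronglyMeasurable (measurableSet_Iio.prod MeasurableSet.univ)
  have hweak0 : IsBoundedWeakNSSolutionOn (Iio 0) isOpen_Iio 1 v :=
    hv.isBoundedWeakNSSolutionOn one_pos hjm fun τ hτ => (hslice τ hτ).aestronglyMeasurable
  -- the window `(a, 0)`, `a = s - 1`, shifted to `(0, T₁)`, `T₁ = 1 - s`
  set a : ℝ := s - 1 with ha
  set T₁ : ℝ := 1 - s with hT₁
  have hT₁pos : 0 < T₁ := by rw [hT₁]; linarith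
  have hJI : ∀ τ : ℝ, τ ∈ Ioo 0 T₁ ↔ τ + a ∈ Ioo a 0 := fun τ => by
    rw [hT₁, ha]
    constructor
    · rintro ⟨h1, h2⟩; exact ⟨by linarith, by linarith⟩
    · rintro ⟨h1, h2⟩; exact ⟨by linarith, by linarith⟩
  set w : ℝ → EuclideanSpace ℝ (Fin 3) → EuclideanSpace ℝ (Fin 3) := fun τ => v (τ + a) with hw
  have hweak : IsBoundedWeakNSSolutionOn (Ioo 0 T₁) isOpen_Ioo 1 w :=
    (hweak0.mono isOpen_Ioo Ioo_subset_Iio_self).comp_add_right a isOpen_Ioo hJI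
  have hcontw : ContinuousOn (uncurry w) (Ioo 0 T₁ ×ˢ univ) := by
    refine hcont.comp (f := fun q : ℝ × EuclideanSpace ℝ (Fin 3) => (q.1 + a, q.2))
      ((continuous_fst.add continuous_const).prodMk continuous_snd).continuousOn ?_
    intro q hq
    exact ⟨((hJI q.1).1 hq.1).2, mem_univ _⟩
  have hwL : ∀ τ ∈ Ioo 0 T₁, ∀ y, ‖w τ y‖ ≤ C := fun τ hτ y => hC (τ + a) ((hJI τ).1 hτ).2 y
  have hwK : ∀ τ ∈ Ioo 0 T₁, eLpNorm (w τ) 6 volume ≤ K := fun τ hτ => hK (τ + a) ((hJI τ).1 hτ).2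
  -- the window theorem between `s - a = 1` and `t - a`
  have hr : 0 < s - a := by rw [ha]; linarith
  have hrt : s - a < t - a := by linarith
  have htT₁ : t - a < T₁ := by rw [hT₁, ha]; linarith
  have key := oseenMild_window hT₁pos hweak hcontw hwL hwK hr hrt htT₁ x
  simp only [hw, sub_add_cancel] at key
  rw [show t - a - (s - a) = t - s by ring] at key
  rw [key, oseenDuhamel_translate 1 (s - a) a v v (t - a) x, sub_add_cancel, sub_add_cancel]

end ParabolicGaldiLiouville.Birth

end Summit.NavierStokesRegularity.NavierStokesRegularity.Theorems
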